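import Summits.QuantumFields.YangMills.Theses.BalabanLadder
import Summits.QuantumFields.YangMills.Theorems.BalabanLadderUVRecord13Sep

/-!
# BalabanLadder ∕ UV — the v1.2 (separated-range) Record-13 station AT THE SPINE LEAF BY NAME: `UVAtParams13Sep 2 → BalabanLadder.UV`,
# `UVAtRecord13CSep 2 → BalabanLadder.UV`, and Track A's rev-18 four item TEXTS ⟹ `BalabanLadder.UV` by name

OS-ASSEMBLY BOOKKEEPING (cell `ym-fleet`, seat `ym-osasm-p1`, director-ym R136 (iii); `--supports stmt-QuantumFields-19351`).  Three one-line theorems;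
0 `sorry`, 0 `def`, standard axioms; COUNT-NEUTRAL.  The `Provisos₁₃Sep` twin of `Theorems/BalabanLadderUVRecord13Tether.lean` (p490767).  This is the ONLY
module of the v1.2 Record-13 station that imports the spine route file `Summits.QuantumFields.YangMills.Theses.BalabanLadder` (a LEAF: nothing imports it);
it does NOT import Track A's route file — the four rev-18 item texts enter through `uvAtParams13Sep_of_chain`'s INLINE binders, which those items feed by
unfolding.  Sensitive only to the TEXT of `BalabanLadder.UV` (owner RULING R27: Stage-0 form kept through R85).

* `uv_of_uvAtParams13Sep_two` — the θ-keyed v1.2 package at `N = 2` gives the spine leaf BY NAME (`stage0_of_uvAtParams13Sep`, definitional unfolding).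
* `uv_of_uvAtRecord13CSep_two` — the same from the (D, w)-keyed package (`stage0_of_uvAtRecord13CSep`).
* `uv_of_record13SepChain_two` — Track A's rev-18 four TEXTS at `N = 2` ⟹ `BalabanLadder.UV` BY NAME; as TERMS it is the re-keyed `BalabanUVNodes.closes`
  (the D-0061 identity junction, desk scratch attached as evidence on stmt-QuantumFields-19351).

HONEST FRAMING.  Modus-ponens glue for HYPOTHESES of a conditional chain (Track A's four ⁗ items are OPEN; 0∕6 spine legs discharged); one finite
four-torus programme per family at fixed ε; NOT infinite volume, NOT OS on ℝ⁴, NOT a mass gap, NOT Clay.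
-/

set_option autoImplicit false

namespace Summit.QuantumFields.YangMills.Cruxes.UV.Record13Sep

open Literature.MathematicalPhysics.QuantumFieldTheory.Balaban1983to89
open Literature.MathematicalPhysics.QuantumFieldTheory.Balaban1983to89.T4Continuum

/-- **THE θ-KEYED STAGE-13 PACKAGE AT `N = 2` GIVES THE SPINE LEAF BY NAME**: `UVAtParams13Sep 2 → Summit.QuantumFields.YangMills.Theses.BalabanLadder.UV`
(the Stage-0 projection `stage0_of_uvAtParams13Sep`; `UV`'s text of record IS that Stage-0 conjunction, owner RULING R27). -/
theorem uv_of_uvAtParams13Sep_two (h : UVAtParams13Sep 2) : Summit.QuantumFields.YangMills.Theses.BalabanLadder.UV :=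
  fun F => stage0_of_uvAtParams13Sep h F

/-- **THE (D, w)-KEYED STAGE-13 PACKAGE AT `N = 2` GIVES THE SPINE LEAF BY NAME** (`stage0_of_uvAtRecord13CSep`). -/
theorem uv_of_uvAtRecord13CSep_two (h : UVAtRecord13CSep 2) : Summit.QuantumFields.YangMills.Theses.BalabanLadder.UV :=
  fun F => stage0_of_uvAtRecord13CSep h F

/-- **TRACK A's REV-16 FOUR ITEM TEXTS AT `N = 2` ⟹ THE SPINE LEAF BY NAME**: inhabitation of the admissible Stage-13 unity tuples with non-degenerate
slots (text of `Record13SepInhabited`, 19909) · (B) + window at some such tuple (`StabilityBAtRecordR13Sep`, 19910) · END given (B) + window (`EndpointGivenBR13Sep`,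
19911) · hybrid-NE7 spine given (B) + END (`SpineGivenEndpointR13Sep`, 19912) ⟹ `BalabanLadder.UV` — through the station (`uvAtParams13Sep_of_chain`, then the
projection).  The items feed these binders by unfolding; as terms this is the rev-18 `BalabanUVNodes.closes`. -/
theorem uv_of_record13SepChain_two
    (h0 : ∀ F : T4Family, ∃ θ : Node00.Stage13Params F 2, θ.Provisos₁₃Sep F 2 ∧ (θ.ZtUnity F 2 ∧ θ.SlotsNondegenerate₁₃ F 2) ∧ θ.Admissible F 2)
    (h1 : ∀ F : T4Family, (∃ θ : Node00.Stage13Params F 2, θ.Provisos₁₃Sep F 2 ∧ (θ.ZtUnity F 2 ∧ θ.SlotsNondegenerate₁₃ F 2) ∧ θ.Admissible F 2) →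
      ∃ (θ : Node00.Stage13Params F 2) (h : θ.Provisos₁₃Sep F 2), (θ.ZtUnity F 2 ∧ θ.SlotsNondegenerate₁₃ F 2) ∧ θ.Admissible F 2 ∧
        B16.EndStatementBPrinted (Node00.datumOfRecord₁₃Sep F 2 θ h).C ∧ ∃ γ₁ : ℝ, 0 < γ₁ ∧ ∀ γ : ℝ, 0 < γ → γ ≤ γ₁ →
          ∃ P : B12.RunParams, 1 ≤ P.K ∧ ((Node00.datumOfRecord₁₃Sep F 2 θ h).C P).flow.InInterval γ P.K)
    (h2 : ∀ (F : T4Family) (θ : Node00.Stage13Params F 2) (h : θ.Provisos₁₃Sep F 2), (θ.ZtUnity F 2 ∧ θ.SlotsNondegenerate₁₃ F 2) → θ.Admissible F 2 →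
      B16.EndStatementBPrinted (Node00.datumOfRecord₁₃Sep F 2 θ h).C → (∃ γ₁ : ℝ, 0 < γ₁ ∧ ∀ γ : ℝ, 0 < γ → γ ≤ γ₁ →
        ∃ P : B12.RunParams, 1 ≤ P.K ∧ ((Node00.datumOfRecord₁₃Sep F 2 θ h).C P).flow.InInterval γ P.K) →
      DagBinding.EndpointExistence (Node00.datumOfRecord₁₃Sep F 2 θ h).C.toB12)
    (h3 : ∀ (F : T4Family) (θ : Node00.Stage13Params F 2) (h : θ.Provisos₁₃Sep F 2), (θ.ZtUnity F 2 ∧ θ.SlotsNondegenerate₁₃ F 2) → θ.Admissible F 2 →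
      B16.EndStatementBPrinted (Node00.datumOfRecord₁₃Sep F 2 θ h).C → DagBinding.EndpointExistence (Node00.datumOfRecord₁₃Sep F 2 θ h).C.toB12 →
      T4ApexHybrid.HybridNE7Under (Node00.datumOfRecord₁₃Sep F 2 θ h) (DagBinding.EndpointExistence (Node00.datumOfRecord₁₃Sep F 2 θ h).C.toB12)) :
    Summit.QuantumFields.YangMills.Theses.BalabanLadder.UV :=
  uv_of_uvAtParams13Sep_two (uvAtParams13Sep_of_chain h0 h1 h2 h3)

end Summit.QuantumFields.YangMills.Cruxes.UV.Record13Sep
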